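import Summits.BirchSwinnertonDyer.BirchSwinnertonDyer.Theorems.KimAtThreeStubOfS24Deep
import Summits.BirchSwinnertonDyer.BirchSwinnertonDyer.Theorems.KimAtThreeDeepLowerS24DeepOfPinned
import Summits.BirchSwinnertonDyer.BirchSwinnertonDyer.Theorems.KimAtThreeShallowEqDeepGoodCoreVertexRat
import Literature.NumberTheory.GaloisCohomology.Sakamoto2024KolyvaginRankOne
import HarnessLib

/-!
# Route `KimAtThreeKolyvagin` (rung W2), crux `StubAtEmptyLevelThree` (item 19561): the stub at `∅`
# FROM THE PINNED [S24] FACT — the liftability road re-keyed from the flagged S24-DEEP port to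
# Sakamoto 2024 Thm. 4.4 (1) AS PRINTED

Cell `bsd-addord`, seat `bsd-addord-w2-c5` (gen 3). TOOL FILE: theorems only, no definition, no named fact, no
`sorry`; closes nothing; books nothing. HONEST FRAMING: BSD is not proved by any of this; item 19561 stays
OPEN (aside); the theorems below are CONDITIONAL on the PUBLISHED, pinned Literature fact
`Sakamoto2024.kolyvaginSystems_freeRankOne_zmod_three_pow` ([S24] Thm. 4.4 (1) over `ℤ/3^m` for Sakamoto's OWN
prime set; refereed) — in place of the FLAGGED PORT S24-DEEP (1)
(`GaloisImage.S24Deep.kolyvaginSystems_freeRankOne_zmod_three_pow_deep`, `S24-DEEP-PORT@3`) which w2-c2 gen 3's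
`KimAtThreeStubOfLiftable.stubShape_of_s24Deep` consumed — and on the same four displayed inputs as that
theorem ([S24] Thm. 4.4 (2) in ORDER form and the Poitou–Tate pair counts at both depths, the three counts
(iii) at the lift level, the order (iv) of `g ∅`). This is item (i) of w2-c2 gen 5's successor list («re-key
the consumers … my gen-3 `KimAtThreeStubOfS24Deep` from `hS24d` to `…_of_pinned`»), executed for crux 19561.

## What

* `kolyvaginSystems_freeRankOne_deep_of_pinned_of_towerSurj` — S24-DEEP (1) for a datum of `E[3^k·3]`
  (`1 ≤ k ≤ k′`) on the DEEP class through `E[3^{k′}·3]`, from the pinned fact ALONE under the tower: the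
  good core vertex `n₀` demanded by w2-c2 gen 5's
  `KimAtThreeDeepLowerS24DeepOfPinned.kolyvaginSystems_freeRankOne_propagatedSelmerStructure_deep_of_pinned`
  is PRODUCED here, row-free, by w2-c4's `exists_superset_kummerSelmerGroup_eq_bot_rat_three_deep` (the
  `3`-descent Selmer group `Sel^{(3)}(E/ℚ)` is finite — Silverman X.4.2 (b), the tree's
  `finite_selmerGroup_holds` — and the Mazur–Rubin greedy choice on the deep class) on the `E[3]`-datum of
  `KimAtThreeDeepLowerS24DeepTower.exists_deepDatum_torsion_three`. So the only input beyond the tower, the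
  Poitou–Tate family at `3` and Tate's local Euler–Poincaré characteristic is the PUB fact `hS24`.
* **`stubShape_of_pinned`** — THE 19561 CONCLUSION `g ∅ = 3^{n₀}•e + m′` for the data of
  `stubShape_of_s24Deep` (levels `1 ≤ k ≤ k̃`, deep datum `D̃`, `D̃.primes ⊆ D_k.primes`, generators `g`, `g̃`),
  binders VERBATIM except: `hS24d` (port) REPLACED by `hS24` (PUB) and `1 ≤ k` added. Proof = w2-c2 gen 3's
  proof with rigidity at the core vertex `d₀` taken from the freeness delivered by the first theorem.

NET for item 19561: on the data the road instantiates, the stub at the empty level follows from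
{[S24] Thm. 4.4 (1) PUB, [S24] Thm. 4.4 (2) in order form + Poitou–Tate pair counts at both depths, the three
counts (iii), the order (iv)} — the flagged port is gone from the 19561 road for every `k ≥ 1`. (`k = 0` is
the `m = 1` slice, n1011's `KolyvaginStubVanishing` / w2-c2 gen 5's `…S24DeepAtOne`; not re-keyed here.)

References: [MazurRubin2004] Thm. 4.4.1, Thm. 4.4.3 (pp. 45–47), §3.5 (H.5), Cor. 4.5.2 (iv);
[Sakamoto2024] Thm. 4.4 (1)(2) (p. 926), Lemma 5.2; [Rubin2011] Thm. 2.8.4, Cor. 2.8.9.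
-/

set_option autoImplicit false
-- the Theorems namespace of a single-conjunct summit repeats the summit name by design (D-0017)
set_option linter.dupNamespace false

noncomputable section

open scoped Classical NumberField ContRepresentation
open Function Field NumberField IsDedekindDomain WeierstrassCurve Literature.NumberTheory.EllipticCurves
  Literature.NumberTheory.GaloisRepresentations Literature.NumberTheory.GaloisRepresentations.DiscreteGaloisModule
  Literature.NumberTheory.GaloisCohomology Literature.NumberTheory.GaloisCohomology.KolyvaginDatum
  Summit.BirchSwinnertonDyer.Rank1Residual.GaloisImage Summit.BirchSwinnertonDyer.Rank1Residual.GaloisImage.Transport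

namespace Summit.BirchSwinnertonDyer.BirchSwinnertonDyer.Theorems.KimAtThreeStubOfLiftable

open Summit.BirchSwinnertonDyer.BirchSwinnertonDyer.Theorems.KimAtThreeDeepLowerS24DeepTower
open Summit.BirchSwinnertonDyer.BirchSwinnertonDyer.Theorems.KimAtThreeDeepLowerS24DeepOfPinned
open Summit.BirchSwinnertonDyer.BirchSwinnertonDyer.Theorems.KimAtThreeShallowEqDeepGoodCoreVertex

/-- **S24-DEEP (1) on the deep class from the PINNED fact alone, under the tower** (the good core vertex
produced): for `1 ≤ k ≤ k′`, `S ⊇ ∞ ∪ {3} ∪ {bad}`, `τ ∈ Γ_{ℚ(μ_{3^{k′+1}})}` with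
`E[3^{k′}·3]/(τ − 1) ≃ ℤ/3^{k′+1}`, a Poitou–Tate family at `3`, Tate's local Euler–Poincaré characteristic,
and a Kolyvagin datum `D` of `E[3^k·3]` with primes THE deep class `frobeniusClassPrimes (E[3^{k′}·3]) S τ 3^{k′+1}`,
cyclotomic transverse conditions and canonical comparison maps for `η`: `KS₁(E[3^k·3], 𝓕_can, 𝒫′)` is free of
rank one over `ℤ/3^{k+1}` and evaluation is bijective at every level with `λ^* = 0`.
[cite: Sakamoto2024, Thm. 4.4 (1) (p. 926)] [cite: MazurRubin2004, §3.5 (H.5) (p. 27) and Cor. 4.5.2 (iv) (p. 48)]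
[cite: SilvermanAEC2009, Thm X.4.2(b)] -/
theorem kolyvaginSystems_freeRankOne_deep_of_pinned_of_towerSurj
    (hS24 : Sakamoto2024.kolyvaginSystems_freeRankOne_zmod_three_pow)
    (W : WeierstrassCurve ℚ) [W.IsElliptic] [Finite (geomTorsion W ((3 : ℕ) : ℤ))]
    {k k' : ℕ} (hk : 1 ≤ k) (hkk' : k ≤ k')
    [Finite (geomTorsion W (((3 : ℕ) : ℤ) ^ k * ((3 : ℕ) : ℤ)))]
    [Finite (geomTorsion W (((3 : ℕ) : ℤ) ^ k' * ((3 : ℕ) : ℤ)))]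
    (htower : ∀ n : ℕ, W.HasSurjectiveModNGaloisRep (3 ^ n : ℕ))
    (τ : absoluteGaloisGroup ℚ) (hτμ : τ ∈ rootsOfUnityFixer ℚ (3 ^ (k' + 1)))
    (hτq' : Nonempty (cokerSubOne (W.torsionGaloisModule (((3 : ℕ) : ℤ) ^ k' * ((3 : ℕ) : ℤ))) τ ≃+
      ZMod (3 ^ (k' + 1))))
    (inv : LocalInvariants ℚ 3) (hperf : inv.IsPerfect) (hsum : inv.SumLocalTermEqZero)
    (hcompl : inv.SelmerComplement)
    (hEP : ∀ v : HeightOneSpectrum (𝓞 ℚ), localEulerPoincareCharacteristic (v.adicCompletion ℚ))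
    (S : Finset (Place ℚ)) (hS : ∀ w : InfinitePlace ℚ, (Sum.inl w : Place ℚ) ∈ S)
    (h3S : ∀ v : HeightOneSpectrum (𝓞 ℚ), ((3 : ℕ) : 𝓞 ℚ) ∈ v.asIdeal → (Sum.inr v : Place ℚ) ∈ S)
    (hbadS : ∀ v : HeightOneSpectrum (𝓞 ℚ), ¬ W.HasGoodReductionAt v → (Sum.inr v : Place ℚ) ∈ S)
    (D : KolyvaginDatum (W.torsionGaloisModule (((3 : ℕ) : ℤ) ^ k * ((3 : ℕ) : ℤ))))
    (η : (q : HeightOneSpectrum (𝓞 ℚ)) → (ZMod (Ideal.absNorm q.asIdeal))ˣ)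
    (hP : D.primes = frobeniusClassPrimes (W.torsionGaloisModule (((3 : ℕ) : ℤ) ^ k' * ((3 : ℕ) : ℤ)))
      {v | (Sum.inr v : Place ℚ) ∈ S} τ (3 ^ (k' + 1)))
    (hT : D.transverse = cyclotomicTransverse (W.torsionGaloisModule (((3 : ℕ) : ℤ) ^ k * ((3 : ℕ) : ℤ))))
    (hD : D.HasCanonicalComparison (3 ^ (k + 1)) η) :
    KolyvaginSystem.IsFreeRankOneZMod (D.kolyvaginSystems (propagatedSelmerStructure W 3 k))
        (3 ^ (k + 1)) ∧
      ∀ (d : Finset (HeightOneSpectrum (𝓞 ℚ))) (hd : D.IsLevel d),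
        LocalInvariants.lambdaStar inv ((D.atLevel (propagatedSelmerStructure W 3 k) d).induced
          (W.torsionMulBy (((3 : ℕ) : ℤ) ^ k) ((3 : ℕ) : ℤ))) 3 = 0 →
        Function.Bijective fun κ : D.kolyvaginSystems (propagatedSelmerStructure W 3 k) =>
          (⟨κ.1 d, ((KolyvaginDatum.mem_kolyvaginSystems_iff D _ κ.1).mp κ.2).mem_selmerGroup
              d hd⟩ : (D.atLevel (propagatedSelmerStructure W 3 k) d).selmerGroup) := by
  haveI : Fact (Nat.Prime 3) := ⟨Nat.prime_three⟩
  have h3 : W.HasSurjectiveModNGaloisRep ((3 : ℕ) : ℤ) := by simpa using htower 1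
  -- `τ` on `E[3]`
  have hτq₁ : Nonempty (cokerSubOne (W.torsionGaloisModule ((3 : ℕ) : ℤ)) τ ≃+ ZMod 3) := by
    have hl' : ((3 : ℕ) : ℤ) ^ (k' + 1) = ((3 : ℕ) : ℤ) ^ k' * ((3 : ℕ) : ℤ) := pow_succ _ _
    have h1 : Nonempty (cokerSubOne (W.torsionGaloisModule (((3 : ℕ) : ℤ) ^ (k' + 1))) τ ≃+
        ZMod (3 ^ (k' + 1))) := by
      rw [hl']; exact hτq'
    have h := nonempty_cokerSubOne_equiv_zmod_pow_of_le W Nat.prime_three (Nat.succ_le_succ (Nat.zero_le k'))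
      τ h1
    have hl : ((3 : ℕ) : ℤ) ^ (0 + 1) = ((3 : ℕ) : ℤ) := by rw [zero_add, pow_one]
    rw [hl] at h
    simpa using h
  -- a generator system `η′` (only its existence matters for the `E[3]`-datum)
  obtain ⟨η', -, hη', -⟩ := exists_eta_eq_on_primes_forall_zpowers_eq_top
    (W.torsionGaloisModule (((3 : ℕ) : ℤ) ^ k * ((3 : ℕ) : ℤ))) hD
  -- the `E[3]`-datum on the deep class and its good core vertex (residual Kummer currency)
  obtain ⟨D₁, hP₁, hT₁, -⟩ := exists_deepDatum_torsion_three W k' {v | (Sum.inr v : Place ℚ) ∈ S}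
    hτμ hτq₁ η' hη'
  haveI : Finite (W.kummerSelmerStructure ((3 : ℕ) : ℤ)).selmerGroup := by
    rw [← selmerGroup_eq_selmerGroup_kummerSelmerStructure]
    exact W.finite_selmerGroup_holds (by norm_num)
  obtain ⟨n₀, -, hn₀, hdual, -, -⟩ := exists_superset_kummerSelmerGroup_eq_bot_rat_three_deep W h3 k' τ
    hτμ hτq₁ inv hperf hsum hcompl S hS h3S hbadS D₁ hP₁ hT₁ (KolyvaginDatum.isLevel_empty D₁)
  have hbot : (inv.dualSelmerStructure (W.torsionGaloisModule ((3 : ℕ) : ℤ))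
      ((W.kummerSelmerStructure ((3 : ℕ) : ℤ)).transverseAt
        (cyclotomicTransverse (W.torsionGaloisModule ((3 : ℕ) : ℤ))) n₀)).selmerGroup = ⊥ := by
    have h := hdual
    change (inv.dualSelmerStructure _ ((W.kummerSelmerStructure ((3 : ℕ) : ℤ)).transverseAt
      D₁.transverse n₀)).selmerGroup = ⊥ at h
    rwa [hT₁] at h
  have hn₀D : D.IsLevel n₀ := fun q hq => by
    rw [hP]
    exact hP₁ ▸ hn₀ hq
  exact kolyvaginSystems_freeRankOne_propagatedSelmerStructure_deep_of_pinned W hS24 hk hkk' htower τ hτμ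
    hτq' inv hperf hsum hcompl hEP S hS h3S hbadS D η hP hT hD hn₀D hbot

/-- **Item 19561's conclusion FROM THE PINNED [S24] Thm. 4.4 (1)** (module docstring): for a tower row,
levels `1 ≤ k ≤ k̃`, the reduction `red` (`x ↦ 3^{k̃−k}x`), a datum `D_k` and a DEEP datum `D̃` (primes = the
class of `τ` at `3^{k̃+1}` through `E[3^{k̃}·3]`, contained in `D_k.primes`, outside `S ⊇ ∞ ∪ {3} ∪ {bad}`),
cyclotomic transverse conditions, canonical comparison maps for one `η`, generators `g`, `g̃` (`g̃` of order
`3^{k̃+1}`) with [S24] (2) in ORDER form and the pair counts at both depths, the three counts (iii) and the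
order (iv): `g ∅ = 3^{n₀}•e + m′`, `e ∈ H¹_{𝓕_can}(ℚ, E[3^{k+1}])`, `m′ ∈ H¹_𝓚` — binders of
`stubShape_of_s24Deep` VERBATIM with the port `hS24d` REPLACED by the pinned fact `hS24` (PUB) and `1 ≤ k`
added. [cite: MazurRubin2004, Thm. 4.4.3 (pp. 46–47)] [cite: Sakamoto2024, Thm. 4.4 (1)(2) (p. 926)] -/
theorem stubShape_of_pinned
    (hS24 : Sakamoto2024.kolyvaginSystems_freeRankOne_zmod_three_pow)
    (W : WeierstrassCurve ℚ) [W.IsElliptic] [Finite (geomTorsion W ((3 : ℕ) : ℤ))]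
    (htower : ∀ n : ℕ, W.HasSurjectiveModNGaloisRep (3 ^ n : ℕ)) {k kt : ℕ} (hk : 1 ≤ k) (hkk : k ≤ kt)
    {n₀ : ℕ}
    [Finite (geomTorsion W (((3 : ℕ) : ℤ) ^ k * ((3 : ℕ) : ℤ)))]
    [Finite (geomTorsion W (((3 : ℕ) : ℤ) ^ kt * ((3 : ℕ) : ℤ)))]
    (red : (W.torsionGaloisModule (((3 : ℕ) : ℤ) ^ kt * ((3 : ℕ) : ℤ))).toContRepresentation →ⁱL
      (W.torsionGaloisModule (((3 : ℕ) : ℤ) ^ k * ((3 : ℕ) : ℤ))).toContRepresentation)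
    (hred : ∀ x : geomTorsion W (((3 : ℕ) : ℤ) ^ kt * ((3 : ℕ) : ℤ)),
      ((red x : geomTorsion W (((3 : ℕ) : ℤ) ^ k * ((3 : ℕ) : ℤ))) : geomPoints W) =
        (((3 : ℕ) : ℤ) ^ (kt - k)) • (x : geomPoints W))
    -- the deepest `τ` and the Poitou–Tate family at `3` (inputs of the deep S24 instance)
    (τ : absoluteGaloisGroup ℚ) (hτμ : τ ∈ rootsOfUnityFixer ℚ (3 ^ (kt + 1)))
    (hτq : Nonempty (cokerSubOne (W.torsionGaloisModule (((3 : ℕ) : ℤ) ^ kt * ((3 : ℕ) : ℤ))) τ ≃+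
      ZMod (3 ^ (kt + 1))))
    (inv₃ : LocalInvariants ℚ 3) (hperf₃ : inv₃.IsPerfect) (hsum₃ : inv₃.SumLocalTermEqZero)
    (hcompl₃ : inv₃.SelmerComplement)
    (hEP : ∀ v : HeightOneSpectrum (𝓞 ℚ), localEulerPoincareCharacteristic (v.adicCompletion ℚ))
    {S : Finset (Place ℚ)} (hS : ∀ w : InfinitePlace ℚ, (Sum.inl w : Place ℚ) ∈ S)
    (h3S : ∀ v : HeightOneSpectrum (𝓞 ℚ), ((3 : ℕ) : 𝓞 ℚ) ∈ v.asIdeal → (Sum.inr v : Place ℚ) ∈ S)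
    (hbadS : ∀ v : HeightOneSpectrum (𝓞 ℚ), ¬ W.HasGoodReductionAt v → (Sum.inr v : Place ℚ) ∈ S)
    -- the data at the two levels
    {Dk : KolyvaginDatum (W.torsionGaloisModule (((3 : ℕ) : ℤ) ^ k * ((3 : ℕ) : ℤ)))}
    {Dt : KolyvaginDatum (W.torsionGaloisModule (((3 : ℕ) : ℤ) ^ kt * ((3 : ℕ) : ℤ)))}
    (hPP : Dt.primes ⊆ Dk.primes)
    (hPt : Dt.primes = frobeniusClassPrimes
      (W.torsionGaloisModule (((3 : ℕ) : ℤ) ^ kt * ((3 : ℕ) : ℤ))) {v | (Sum.inr v : Place ℚ) ∈ S} τ (3 ^ (kt + 1)))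
    (hTk : Dk.transverse = cyclotomicTransverse _) (hTt : Dt.transverse = cyclotomicTransverse _)
    {η : (q : HeightOneSpectrum (𝓞 ℚ)) → (ZMod (Ideal.absNorm q.asIdeal))ˣ}
    (hDk : Dk.HasCanonicalComparison (3 ^ (k + 1)) η) (hDt : Dt.HasCanonicalComparison (3 ^ (kt + 1)) η)
    -- the generators at the two levels ([S24] Thm. 4.4 (1) outputs)
    {g : Finset (HeightOneSpectrum (𝓞 ℚ)) →
      galoisCohomology (W.torsionGaloisModule (((3 : ℕ) : ℤ) ^ k * ((3 : ℕ) : ℤ))) 1}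
    (hg : g ∈ Dk.kolyvaginSystems (propagatedSelmerStructure W 3 k))
    {gt : Finset (HeightOneSpectrum (𝓞 ℚ)) →
      galoisCohomology (W.torsionGaloisModule (((3 : ℕ) : ℤ) ^ kt * ((3 : ℕ) : ℤ))) 1}
    (hgt : gt ∈ Dt.kolyvaginSystems (propagatedSelmerStructure W 3 kt))
    (hgto : addOrderOf gt = 3 ^ (kt + 1))
    -- [S24] Thm. 4.4 (2) in ORDER form and the pair counts, both depths (full-level PT families)
    (inv : LocalInvariants ℚ (3 ^ (k + 1))) (inv' : LocalInvariants ℚ (3 ^ (kt + 1)))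
    (hR22 : ∀ d, Dk.IsLevel d →
      (Nat.card (inv.dualSelmerStructure _ (Dk.atLevel (propagatedSelmerStructure W 3 k) d)).selmerGroup
          ∣ 3 ^ (k + 1) →
        addOrderOf (g d) * Nat.card (inv.dualSelmerStructure _
          (Dk.atLevel (propagatedSelmerStructure W 3 k) d)).selmerGroup = 3 ^ (k + 1)) ∧
      (3 ^ (k + 1) ∣ Nat.card (inv.dualSelmerStructure _
          (Dk.atLevel (propagatedSelmerStructure W 3 k) d)).selmerGroup → g d = 0))
    (hR22' : ∀ d, Dt.IsLevel d →
      (Nat.card (inv'.dualSelmerStructure _ (Dt.atLevel (propagatedSelmerStructure W 3 kt) d)).selmerGroup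
          ∣ 3 ^ (kt + 1) →
        addOrderOf (gt d) * Nat.card (inv'.dualSelmerStructure _
          (Dt.atLevel (propagatedSelmerStructure W 3 kt) d)).selmerGroup = 3 ^ (kt + 1)) ∧
      (3 ^ (kt + 1) ∣ Nat.card (inv'.dualSelmerStructure _
          (Dt.atLevel (propagatedSelmerStructure W 3 kt) d)).selmerGroup → gt d = 0))
    (hPT : ∀ d, Dk.IsLevel d →
      Nat.card (Dk.atLevel (propagatedSelmerStructure W 3 k) d).selmerGroup =
        3 ^ (k + 1) * Nat.card (inv.dualSelmerStructure _
          (Dk.atLevel (propagatedSelmerStructure W 3 k) d)).selmerGroup)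
    (hPT' : ∀ d, Dt.IsLevel d →
      Nat.card (Dt.atLevel (propagatedSelmerStructure W 3 kt) d).selmerGroup =
        3 ^ (kt + 1) * Nat.card (inv'.dualSelmerStructure _
          (Dt.atLevel (propagatedSelmerStructure W 3 kt) d)).selmerGroup)
    -- (iii) the three counts on `S̃ = H¹_{𝓕_can}(ℚ, E[3^{k̃+1}])`
    [Finite (propagatedSelmerStructure W 3 kt).selmerGroup]
    (hcard : Nat.card (propagatedSelmerStructure W 3 kt).selmerGroup = 3 ^ (kt + 1 + n₀))
    (hcardj : Nat.card {y : (propagatedSelmerStructure W 3 kt).selmerGroup // 3 ^ (kt - k) • y = 0} =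
      3 ^ (kt - k + n₀))
    (hcardtop : Nat.card {y : (propagatedSelmerStructure W 3 kt).selmerGroup // 3 ^ kt • y = 0} =
      3 ^ (kt + n₀))
    -- (iv) the order of the bottom class
    (hord : addOrderOf (g ∅) * 3 ^ n₀ = 3 ^ (k + 1)) :
    ∃ e ∈ (propagatedSelmerStructure W 3 k).selmerGroup,
      ∃ m' ∈ (W.kummerSelmerStructure (((3 : ℕ) : ℤ) ^ k * ((3 : ℕ) : ℤ))).selmerGroup,
        g ∅ = 3 ^ n₀ • e + m' := by
  haveI : Fact (Nat.Prime 3) := ⟨Nat.prime_three⟩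
  haveI : Fact (1 < 3 ^ (k + 1)) := ⟨Nat.one_lt_pow (Nat.succ_ne_zero _) (by norm_num)⟩
  haveI : NeZero (3 ^ (k + 1)) := ⟨pow_ne_zero _ (by norm_num)⟩
  have hsurj : W.HasSurjectiveModNGaloisRep ((3 : ℕ) : ℤ) := by simpa using htower 1
  have hK : Dk.IsKolyvaginSystem (propagatedSelmerStructure W 3 k) g :=
    (KolyvaginDatum.mem_kolyvaginSystems_iff _ _ _).mp hg
  have hKt : Dt.IsKolyvaginSystem (propagatedSelmerStructure W 3 kt) gt :=
    (KolyvaginDatum.mem_kolyvaginSystems_iff _ _ _).mp hgt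
  -- (L-c): a core vertex `d₀` with `red_*(g̃ d₀) = w • g d₀`, `3 ∤ w` (landed)
  obtain ⟨d₀, hd₀, -, hN, w, hw, hcmp⟩ := exists_coreVertex_map_red_eq_smul W hkk Dk Dt red hred hsurj
    hTk hTt hPP inv inv' hg hgt hgto hR22 hR22' hPT hPT'
  have hgo₀ : addOrderOf (g d₀) = 3 ^ (k + 1) := by
    have h := (hR22 d₀ (Set.Subset.trans hd₀ hPP)).1 (by rw [hN]; exact one_dvd _)
    rwa [hN, mul_one] at h
  -- the restricted (deep) datum at level `k`
  let Dr : KolyvaginDatum (W.torsionGaloisModule (((3 : ℕ) : ℤ) ^ k * ((3 : ℕ) : ℤ))) :=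
    { Dk with primes := Dt.primes }
  have hDr : Dr.HasCanonicalComparison (3 ^ (k + 1)) η := KSRestrict.hasCanonicalComparison_restrictPrimes hDk hPP
  have hgr : (fun d : Finset (HeightOneSpectrum (𝓞 ℚ)) =>
        if (↑d : Set (HeightOneSpectrum (𝓞 ℚ))) ⊆ Dt.primes then g d else 0) ∈
      Dr.kolyvaginSystems (propagatedSelmerStructure W 3 k) :=
    KSRestrict.mem_kolyvaginSystems_restrictPrimes hg hPP
  -- (L-a) from the PINNED fact: freeness of `KS₁` of the deep datum, rigidity at `d₀`
  obtain ⟨hfree, -⟩ := kolyvaginSystems_freeRankOne_deep_of_pinned_of_towerSurj hS24 W hk hkk htower τ hτμ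
    hτq inv₃ hperf₃ hsum₃ hcompl₃ hEP S hS h3S hbadS Dr η hPt hTk hDr
  have hinj : ∀ s : Finset (HeightOneSpectrum (𝓞 ℚ)) →
        galoisCohomology (W.torsionGaloisModule (((3 : ℕ) : ℤ) ^ k * ((3 : ℕ) : ℤ))) 1,
      Dr.IsKolyvaginSystem (propagatedSelmerStructure W 3 k) s → s d₀ = 0 → s ∅ = 0 := by
    intro s hs hs0
    have hgo₀' : addOrderOf ((fun d : Finset (HeightOneSpectrum (𝓞 ℚ)) =>
        if (↑d : Set (HeightOneSpectrum (𝓞 ℚ))) ⊆ Dt.primes then g d else 0) d₀) = 3 ^ (k + 1) := by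
      rw [KSRestrict.restrictPrimes_apply_of_subset _ _ hd₀, hgo₀]
    have h := apply_eq_zero_of_free_of_fullOrder hfree hgr hgo₀'
      ((KolyvaginDatum.mem_kolyvaginSystems_iff _ _ _).mpr hs) hs0
    rw [h, Pi.zero_apply]
  -- the liftability road (landed assembly)
  have hPS : ∀ q ∈ Dt.primes, (Sum.inr q : Place ℚ) ∉ S := fun q hq => by
    rw [hPt] at hq
    exact hq.1
  exact stubShape_of_coreVertex_inputs W hsurj hkk red hred hS h3S hbadS hPP (le_of_eq hPt) hPS hTk hTt hDk
    hDt hK hKt hinj hd₀ hw hcmp hcard hcardj hcardtop hord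

end Summit.BirchSwinnertonDyer.BirchSwinnertonDyer.Theorems.KimAtThreeStubOfLiftable

end
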